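import Summits.BirchSwinnertonDyer.BirchSwinnertonDyer.Theorems.EisensteinPrimesAnalyticLambdaCalculus
import Summits.BirchSwinnertonDyer.Rank1Residual.X2.IsogenyLambdaInvariant
import Literature.NumberTheory.EllipticCurves.IwasawaSelmerDualProofs
import HarnessLib

/-!
# Route `EisensteinPrimes`, line `mudescent`, stub `stub_lambdaCount_offLocus` — given `μ_an = 0`,
# the stub at a pair IS Mazur's main conjecture at the pair (helper file 2/2; closes nothing)

Seat `bsd-eis-lam-a` (PROGRAMME PART 1b, ACCEL-LIST (4)), items stmt-BirchSwinnertonDyer-19033 =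
crux 3 `MazurMCOnCellB` (and -19035 = crux 5, X1 currency, not treated here); skeleton owner
bsd-eis-ky, `Lines/mudescent.lean`. File 1/2: `EisensteinPrimesAnalyticLambdaCalculus` (the
analytic conjunct is well defined and a class invariant).

HONEST FRAMING. Nothing here proves a main conjecture or moves a label; theorems only.

* §1 `lambdaInvariant_eq_of_kerSubgroup_eq` — the `λ`-invariant of
  `X(E/ℚ_∞) = Sel_{p^∞}(E/ℚ_∞)^∨` does not depend on the presentation `κ : Γ_ℚ ↠ ℤ_p` of the
  cyclotomic tower (only on `ker κ`) nor on the generator `γ` fixing the `Λ`-structure: two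
  Pontryagin-dual data over `(κ, γ)`, `(κ₁, γ₁)` with `ker κ = ker κ₁` have `ℤ_p`-isomorphic `X`
  (transport through the common character group; `ℤ_p`-linearity from `toDual_C_smul` and the
  `p^k`-torsion of Selmer classes), and the tree's `lambdaInvariant = dim_{ℚ_p}(ℚ_p ⊗_{ℤ_p} X)` sees
  only the `ℤ_p`-structure. Needed because the typed `AlgebraicLambdaGE` quantifies over ALL
  cyclotomic `κ` and ALL topological generators `γ`, while `X2.MazurMainConjectureAt` (and Wuthrich's
  Thm. 16) speak at the normalised `γ` (`IsCyclotomicVariable`).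
* §2 `exists_lambdaCount_of_mazurMainConjectureAt` — conversely to the skeleton's route T
  (`X2.mazurMainConjectureAt_of_algebraicLambdaGE`: stub 3 + stub 4 + Wuthrich ⇒ MC at `W₀`),
  Mazur's main conjecture at `(W, p)` IMPLIES the stub's conclusion at `(W, p)` (given modularity
  and `ϖ·L_p ≠ 0`, read off any `AnalyticMuLE W p m`): `k := λ(g)` for a characteristic generator,
  `n := e + k`, the analytic conjunct by the uniqueness of file 1/2, the algebraic conjunct at every
  `(κ₁, γ₁, D₁)` by §1 and the structure theorem (`lam_generator_eq_lambdaInvariant`).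
  `lambdaCount_iff_mazurMainConjectureAt` packages both directions: AT A PAIR WITH `μ_an = 0`
  (stub 3), STUB 4 ⟺ `X2.MazurMainConjectureAt` — the stub is the `λ`-half of the crux at the pair
  (ky MEMO-4-K5 §3 "MC at (E₀,3) ⟺ λ_alg(E₀) ≥ Λ_an − 1", lam-b MEMO-1 §0), now in the kernel:
  CRUX-SIZED, not a lemma toward it; the missing object on a ¬GVPar row is the one inequality
  `λ(X(W₀/ℚ_∞)) ≥ λ_an(W₀, p) − e`, with no printed theorem (GV 2000 p. 5, p. 42).

References: [GreenbergVatsal2000] p. 4 (after Thm. (1.2)), p. 5, p. 28, §3 p. 42; [Wuthrich2014]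
Thm. 16; [MazurTateTeitelbaum1986Invent] §I.10, §I.14; [Washington1997] §13.2;
HOME/lam-b-MEMO-1.md; HOME/bsd-eis-ky-MEMO-4-K5.md §3.
-/

set_option linter.dupNamespace false
set_option autoImplicit false

noncomputable section

open scoped Classical MatrixGroups ModularForm TensorProduct

open PowerSeries CongruenceSubgroup WeierstrassCurve Literature.NumberTheory.EllipticCurves
  Literature.NumberTheory.EllipticCurves.ModularForms
  Literature.NumberTheory.EllipticCurves.Rank1Residual
  Literature.NumberTheory.EllipticCurves.Wuthrich2014
  Summit.BirchSwinnertonDyer.Rank1Residual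
  Summit.BirchSwinnertonDyer.Rank1Residual.X1.MuLambda
  Summit.BirchSwinnertonDyer.Rank1Residual.X1.ParitySqueeze
  Summit.BirchSwinnertonDyer.Rank1Residual.X1.TamagawaSqueeze
  Summit.BirchSwinnertonDyer.BirchSwinnertonDyer.Theorems.EisensteinPrimesAnalyticLambdaCalculus

namespace Summit.BirchSwinnertonDyer.BirchSwinnertonDyer.Theorems.EisensteinPrimesAnalyticLambdaCruxSized

/-! ## §1. `λ(X(E/ℚ_∞))` does not depend on the choice of the cyclotomic datum `(κ, γ)` -/

section Independence

variable {W : WeierstrassCurve ℚ} [W.IsElliptic] {p : ℕ} [Fact p.Prime]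
  {κ κ₁ : ZpExtension ℚ p} {γ γ₁ : Field.absoluteGaloisGroup ℚ}

omit [W.IsElliptic] [Fact p.Prime] in
/-- Equal subgroups give (trivially) isomorphic Selmer groups over them. [folklore] -/
theorem nonempty_addEquiv_selmerGroupOver_of_eq {S₁ S₂ : Subgroup (Field.absoluteGaloisGroup ℚ)}
    [S₁.Normal] [S₂.Normal] (h : S₁ = S₂) :
    Nonempty (W.selmerGroupOver p S₁ ≃+ W.selmerGroupOver p S₂) := by
  subst h
  exact ⟨AddEquiv.refl _⟩

omit [W.IsElliptic] in
/-- **The `λ`-invariant of the Iwasawa module `X(E/K_∞) = Sel_{p^∞}(E/K_∞)^∨` depends only on the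
field `K_∞` (i.e. on `ker κ`), not on the presentation `κ : Γ_ℚ ↠ ℤ_p` nor on the generator `γ`
fixing the `Λ`-structure.** For two Pontryagin-dual data `D` over `(κ, γ)` and `D₁` over
`(κ₁, γ₁)` with `ker κ = ker κ₁` (e.g. both cyclotomic: `ZpExtension.IsCyclotomic` is an equation
for `ker κ`), `λ(D.X) = λ(D₁.X)`: both `X`'s are character groups of the same Selmer group, the
transports of structure are mutually inverse and `ℤ_p`-linear (`toDual_C_smul`; every Selmer class
is `p^k`-torsion, `exists_pow_smul_subgroupH1_ker_eq_zero`), and the tree's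
`lambdaInvariant = dim_{ℚ_p}(ℚ_p ⊗_{ℤ_p} X)` sees only the `ℤ_p`-structure (the `Λ`-structures
differ by `T ↦ (1+T)^a − 1`). Used to feed the over-quantified `AlgebraicLambdaGE` (all `κ`, all
`γ`) from Mazur's main conjecture (stated at the normalised `γ`). [folklore] -/
theorem lambdaInvariant_eq_of_kerSubgroup_eq (D : W.SelmerDualData κ γ)
    (D₁ : W.SelmerDualData κ₁ γ₁) (h : κ.kerSubgroup = κ₁.kerSubgroup) :
    lambdaInvariant p D.X = lambdaInvariant p D₁.X := by
  have e : W.selmerInfty κ ≃+ W.selmerInfty κ₁ :=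
    (nonempty_addEquiv_selmerGroupOver_of_eq (W := W) (p := p) h).some
  -- the `ℤ_p`-structures by restriction of scalars along `ℤ_p → Λ` (as in `lambdaInvariant`)
  letI iX : Module ℤ_[p] D.X := Module.compHom D.X (algebraMap ℤ_[p] (IwasawaAlgebra p))
  letI iX₁ : Module ℤ_[p] D₁.X := Module.compHom D₁.X (algebraMap ℤ_[p] (IwasawaAlgebra p))
  let eD : D.X ≃+ (W.selmerInfty κ →+ AddCircle (1 : ℚ)) := AddEquiv.ofBijective D.toDual D.bijective
  let eD₁ : D₁.X ≃+ (W.selmerInfty κ₁ →+ AddCircle (1 : ℚ)) :=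
    AddEquiv.ofBijective D₁.toDual D₁.bijective
  -- transports of structure through the character groups
  let F₀ : D₁.X →+ D.X :=
    { toFun := fun x₁ ↦ eD.symm ((D₁.toDual x₁).comp e.toAddMonoidHom)
      map_zero' := by rw [map_zero, AddMonoidHom.zero_comp, map_zero]
      map_add' := fun x y ↦ by rw [← map_add, map_add, AddMonoidHom.add_comp] }
  let G₀ : D.X →+ D₁.X :=
    { toFun := fun x ↦ eD₁.symm ((D.toDual x).comp e.symm.toAddMonoidHom)
      map_zero' := by rw [map_zero, AddMonoidHom.zero_comp, map_zero]
      map_add' := fun x y ↦ by rw [← map_add, map_add, AddMonoidHom.add_comp] }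
  have hF : ∀ x₁, D.toDual (F₀ x₁) = (D₁.toDual x₁).comp e.toAddMonoidHom := fun x₁ ↦ by
    change eD (eD.symm _) = _
    rw [AddEquiv.apply_symm_apply]
  have hG : ∀ x, D₁.toDual (G₀ x) = (D.toDual x).comp e.symm.toAddMonoidHom := fun x ↦ by
    change eD₁ (eD₁.symm _) = _
    rw [AddEquiv.apply_symm_apply]
  -- torsion of Selmer classes on both sides
  have htor : ∀ s : W.selmerInfty κ, ∃ k : ℕ, p ^ k • s = 0 := fun s ↦ by
    obtain ⟨k, hk⟩ := W.exists_pow_smul_subgroupH1_ker_eq_zero κ (s : W.subgroupH1 p κ.kerSubgroup)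
    exact ⟨k, Subtype.ext (by rw [AddSubmonoidClass.coe_nsmul]; exact hk)⟩
  have htor₁ : ∀ s : W.selmerInfty κ₁, ∃ k : ℕ, p ^ k • s = 0 := fun s ↦ by
    obtain ⟨k, hk⟩ := W.exists_pow_smul_subgroupH1_ker_eq_zero κ₁ (s : W.subgroupH1 p κ₁.kerSubgroup)
    exact ⟨k, Subtype.ext (by rw [AddSubmonoidClass.coe_nsmul]; exact hk)⟩
  -- `ℤ_p`-linearity of the transports
  have hFsmul : ∀ (c : ℤ_[p]) (x₁ : D₁.X), F₀ (PowerSeries.C c • x₁) = PowerSeries.C c • F₀ x₁ := by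
    intro c x₁
    apply D.bijective.1
    rw [hF]
    ext s
    obtain ⟨k, hks⟩ := htor s
    have hke : p ^ k • e s = 0 := by rw [← map_nsmul, hks, map_zero]
    rw [AddMonoidHom.comp_apply, AddEquiv.coe_toAddMonoidHom, D₁.toDual_C_smul c x₁ (e s) k hke,
      D.toDual_C_smul c (F₀ x₁) s k hks, hF, AddMonoidHom.comp_apply, AddEquiv.coe_toAddMonoidHom]
  have hGsmul : ∀ (c : ℤ_[p]) (x : D.X), G₀ (PowerSeries.C c • x) = PowerSeries.C c • G₀ x := by
    intro c x
    apply D₁.bijective.1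
    rw [hG]
    ext s
    obtain ⟨k, hks⟩ := htor₁ s
    have hke : p ^ k • e.symm s = 0 := by rw [← map_nsmul, hks, map_zero]
    rw [AddMonoidHom.comp_apply, AddEquiv.coe_toAddMonoidHom, D.toDual_C_smul c x (e.symm s) k hke,
      D₁.toDual_C_smul c (G₀ x) s k hks, hG, AddMonoidHom.comp_apply, AddEquiv.coe_toAddMonoidHom]
  -- mutually inverse
  have hFG : ∀ x, F₀ (G₀ x) = x := fun x ↦ by
    apply D.bijective.1
    rw [hF]
    ext s
    rw [AddMonoidHom.comp_apply, AddEquiv.coe_toAddMonoidHom, hG, AddMonoidHom.comp_apply,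
      AddEquiv.coe_toAddMonoidHom, AddEquiv.symm_apply_apply]
  have hGF : ∀ x₁, G₀ (F₀ x₁) = x₁ := fun x₁ ↦ by
    apply D₁.bijective.1
    rw [hG]
    ext s
    rw [AddMonoidHom.comp_apply, AddEquiv.coe_toAddMonoidHom, hF, AddMonoidHom.comp_apply,
      AddEquiv.coe_toAddMonoidHom, AddEquiv.apply_symm_apply]
  -- the `ℤ_p`-linear maps and the dimension count
  let F : D₁.X →ₗ[ℤ_[p]] D.X :=
    { toFun := F₀
      map_add' := F₀.map_add
      map_smul' := fun c x₁ ↦ by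
        change F₀ (algebraMap ℤ_[p] (IwasawaAlgebra p) c • x₁) =
          algebraMap ℤ_[p] (IwasawaAlgebra p) c • F₀ x₁
        rw [← PowerSeries.C_eq_algebraMap]
        exact hFsmul c x₁ }
  let G : D.X →ₗ[ℤ_[p]] D₁.X :=
    { toFun := G₀
      map_add' := G₀.map_add
      map_smul' := fun c x ↦ by
        change G₀ (algebraMap ℤ_[p] (IwasawaAlgebra p) c • x) =
          algebraMap ℤ_[p] (IwasawaAlgebra p) c • G₀ x
        rw [← PowerSeries.C_eq_algebraMap]
        exact hGsmul c x }
  have h1 : F.comp G = (1 : ℤ_[p]) • LinearMap.id := by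
    ext x
    change F₀ (G₀ x) = _
    rw [hFG, one_smul, LinearMap.id_apply]
  have h2 : G.comp F = (1 : ℤ_[p]) • LinearMap.id := by
    ext x₁
    change G₀ (F₀ x₁) = _
    rw [hGF, one_smul, LinearMap.id_apply]
  have hunit : IsUnit (algebraMap ℤ_[p] ℚ_[p] 1) := by rw [map_one]; exact isUnit_one
  have key := X2.IsogenyLambdaInvariant.finrank_baseChange_eq_of_quasiInverse ℚ_[p] F G 1 hunit h1 h2
  change Module.finrank ℚ_[p] (ℚ_[p] ⊗[ℤ_[p]] D.X) = Module.finrank ℚ_[p] (ℚ_[p] ⊗[ℤ_[p]] D₁.X)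
  exact key

end Independence

/-! ## §2. Given `L_p ≠ 0`, the stub's conclusion at `(W, p)` FOLLOWS FROM Mazur's main conjecture -/

section Converse

variable {W : WeierstrassCurve ℚ} [W.IsElliptic] [W.IsGloballyMinimal] {p : ℕ} [Fact p.Prime]

/-- **Mazur's main conjecture at `(W, p)` implies the conclusion of `stub_lambdaCount_offLocus` at
`(W, p)`.** `W/ℚ` globally minimal elliptic, `p` multiplicative; modularity (`hpar`) and any
`AnalyticMuLE W p m` (only used for `ϖ·L ≠ 0`). If `X2.MazurMainConjectureAt W p` holds then
`∃ n k, X2.AnalyticLambdaEq W p n ∧ AlgebraicLambdaGE W p k ∧ (¬split → n ≤ k) ∧ (split → n ≤ k+1)`: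
take `k := λ(g)` for a characteristic generator `g` at the cyclotomic datum and `n := e + k`
(`ι(T^e·g·w) = ϖ·L`, `w ∈ Λˣ`); every other torsion dual datum `D'` has `λ(D'.X) = λ(g') = λ(g)`
because `T^e·g'·w' = T^e·g·w` by the uniqueness of THE `p`-adic `L`-function and of `ι`
(`lam_eq_lam_of_isIsogenous_of_data`), and `λ(D'.X) = λ(g')` by the structure theorem
(`lam_generator_eq_lambdaInvariant`). Together with the skeleton's route T
(`X2.mazurMainConjectureAt_of_algebraicLambdaGE`: stubs 3 + 4 + Wuthrich Thm. 16 ⇒ MC), this says: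
GIVEN `μ_an(W₀) = 0`, stub 4 at `W₀` ⟺ Mazur's main conjecture at `(W₀, p)` — the stub is the
`λ`-half of the crux at the pair, not a lemma toward it. [cite: GreenbergVatsal2000, p. 4 (after Thm. (1.2))]
[cite: MazurTateTeitelbaum1986Invent, §I.14] -/
theorem exists_lambdaCount_of_mazurMainConjectureAt (hpar : nonempty_modularParametrizationData)
    (hmult : W.HasMultiplicativeReductionAtPrime p) {m : ℕ} (hμ : X2.AnalyticMuLE W p m)
    (hMC : X2.MazurMainConjectureAt W p) :
    ∃ n k : ℕ, X2.AnalyticLambdaEq W p n ∧ AlgebraicLambdaGE W p k ∧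
      (¬ W.HasSplitMultiplicativeReductionAtPrime p → n ≤ k) ∧
      (W.HasSplitMultiplicativeReductionAtPrime p → n ≤ k + 1) := by
  haveI : NeZero (W.conductorNorm ℤ) := ⟨(W.conductorNorm_pos_holds).ne'⟩
  obtain ⟨Dm⟩ := hpar W
  have hf : IsNewformOf W Dm.f := Dm.isNewformOf
  obtain ⟨ϖ, -, hϖ, -⟩ := Dm.exists_rat_mul_realPeriodRat_eq_plusPeriod
  obtain ⟨κ, hκ, γ, hγ, hγ'⟩ := exists_isCyclotomic_isTopGenerator_isCyclotomicVariable_holds p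
  obtain ⟨D⟩ := W.nonempty_selmerDualData_holds κ γ hγ
  haveI : Module.Finite (IwasawaAlgebra p) D.X := D.module_finite_holds hγ
  obtain ⟨hXt, g, hchar, hS, hNS⟩ := hMC κ γ hκ hγ hγ' Dm.f hf D ϖ hϖ
  -- THE `p`-adic `L`-function, the unit `w`, and the integral `G = T^e·g·w`
  have key : ∃ (L : PowerSeries ℚ_[p]) (e : ℕ) (w : (IwasawaAlgebra p)ˣ),
      (W.HasSplitMultiplicativeReductionAtPrime p → IsSplitMultPAdicLFunctionOf Dm.f p L) ∧
      (¬ W.HasSplitMultiplicativeReductionAtPrime p → IsMultPAdicLFunctionOf Dm.f p (-1) L) ∧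
      (¬ W.HasSplitMultiplicativeReductionAtPrime p → e = 0) ∧
      (W.HasSplitMultiplicativeReductionAtPrime p → e = 1) ∧
      iwasawaToPowerSeries p (PowerSeries.X ^ e * g * (w : IwasawaAlgebra p)) =
        PowerSeries.C ((ϖ : ℚ) : ℚ_[p]) * L := by
    by_cases hs : W.HasSplitMultiplicativeReductionAtPrime p
    · obtain ⟨L, hL⟩ := exists_isSplitMultPAdicLFunctionOf hs hf
      obtain ⟨w, hw⟩ := hS hs L hL
      exact ⟨L, 1, w, fun _ ↦ hL, fun hns ↦ absurd hs hns, fun hns ↦ absurd hs hns, fun _ ↦ rfl,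
        by rw [pow_one]; exact hw⟩
    · obtain ⟨L, hL⟩ := exists_isMultPAdicLFunctionOf_neg_one_of_nonsplit hf hmult hs
      obtain ⟨w, hw⟩ := hNS hs L hL
      exact ⟨L, 0, w, fun h ↦ absurd h hs, fun _ ↦ hL, fun _ ↦ rfl, fun h ↦ absurd h hs,
        by rw [pow_zero, one_mul]; exact hw⟩
  obtain ⟨L, e, w, hLs, hLn, he0, he1, hG⟩ := key
  -- `ϖ·L ≠ 0`, so `g ≠ 0`
  obtain ⟨k', hk'⟩ := hμ Dm.f hf ϖ hϖ L hLs hLn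
  have hL0 : PowerSeries.C ((ϖ : ℚ) : ℚ_[p]) * L ≠ 0 := X2.ne_zero_of_lt_norm_coeff hk'
  have hG0 : PowerSeries.X ^ e * g * (w : IwasawaAlgebra p) ≠ 0 := by
    intro h0; apply hL0; rw [← hG, h0, map_zero]
  have hg0 : g ≠ 0 := fun h0 ↦ hG0 (by rw [h0, mul_zero, zero_mul])
  have hw0 : (w : IwasawaAlgebra p) ≠ 0 := (Units.isUnit w).ne_zero
  have hXe0 : (PowerSeries.X : IwasawaAlgebra p) ^ e ≠ 0 := pow_ne_zero _ PowerSeries.X_ne_zero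
  have hlamG : lam (PowerSeries.X ^ e * g * (w : IwasawaAlgebra p)) = e + lam g := by
    rw [lam_mul (mul_ne_zero hXe0 hg0) hw0, lam_mul hXe0 hg0, lam_eq_zero_of_isUnit (Units.isUnit w),
      lam_pow PowerSeries.X_ne_zero, X2.lam_X]
    ring
  refine ⟨e + lam g, lam g, ?_, ?_, fun hns ↦ by rw [he0 hns]; omega,
    fun hs ↦ by rw [he1 hs]; omega⟩
  · -- the analytic conjunct: any datum has the same `λ`
    intro N' _ f' hf' ϖ' hϖ' L' hLs' hLn' G' hG'
    rw [← hlamG]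
    exact (lam_eq_lam_of_isIsogenous_of_data (IsIsogenous.refl_holds (W := W)) hf hf' hϖ hϖ'
      hLs hLn hLs' hLn' hG hG').symm
  · -- the algebraic conjunct: every cyclotomic torsion dual datum `D₁` (ANY `κ₁`, `γ₁`) has
    -- `λ(D₁.X) = λ(D.X) = λ(g)` (`lambdaInvariant_eq_of_kerSubgroup_eq`, structure theorem)
    intro κ₁ γ₁ hκ₁ _ D₁ _ _
    have hker : κ.kerSubgroup = κ₁.kerSubgroup := hκ.trans hκ₁.symm
    rw [← lambdaInvariant_eq_of_kerSubgroup_eq D D₁ hker,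
      ← lam_generator_eq_lambdaInvariant D.X hXt hg0 hchar]

/-- **Stub 4 of `mudescent` at a pair with `μ_an = 0` IS Mazur's main conjecture at that pair.**
At an odd reducible multiplicative prime `p` of the globally minimal `W/ℚ` with
`X2.AnalyticMuLE W p 0` (stub 3 of the line), granted Wuthrich 2014 Thm. 16 (`hWu`) and modularity
(`hpar`): the registered conclusion of `stub_lambdaCount_offLocus` at `(W, p)` —
`∃ n k, X2.AnalyticLambdaEq W p n ∧ AlgebraicLambdaGE W p k ∧ (¬split → n ≤ k) ∧ (split → n ≤ k + 1)`
— is EQUIVALENT to `X2.MazurMainConjectureAt W p`. (`→`: the tree's route T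
`X2.mazurMainConjectureAt_of_algebraicLambdaGE`; `←`: `exists_lambdaCount_of_mazurMainConjectureAt`.)
Read at the étale end `W₀` of the skeleton `MazurMCOnCellB_of`: modulo stub 3, stub 4 is the crux
at the located pair (and, Mazur's conjecture being a ℚ-isogeny invariant at rank `0` in the tree,
`X2.mazurMainConjectureAt_of_isIsogenous`, at the displayed pair) — CRUX-SIZED; the obstruction is
entirely the inequality `λ(X(W₀/ℚ_∞)) ≥ λ_an(W₀, p) − e`, for which no printed theorem exists on a
¬GVPar row (GV 2000 p. 5, p. 42; lam-b MEMO-1 §3–§4). [cite: Wuthrich2014, Thm. 16 (p. 397)]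
[cite: GreenbergVatsal2000, p. 4 (after Thm. (1.2)), p. 5 and §3 p. 42] -/
theorem lambdaCount_iff_mazurMainConjectureAt (hWu : thm16_charIdeal_dvd_multiplicative_of_reducible)
    (hpar : nonempty_modularParametrizationData) (hp2 : p ≠ 2)
    (hmult : W.HasMultiplicativeReductionAtPrime p) (hred : ¬ W.HasIrreducibleModPGaloisRep p)
    (hμ0 : X2.AnalyticMuLE W p 0) :
    (∃ n k : ℕ, X2.AnalyticLambdaEq W p n ∧ AlgebraicLambdaGE W p k ∧
      (¬ W.HasSplitMultiplicativeReductionAtPrime p → n ≤ k) ∧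
      (W.HasSplitMultiplicativeReductionAtPrime p → n ≤ k + 1)) ↔ X2.MazurMainConjectureAt W p :=
  ⟨fun ⟨_, _, hlam, halg, hkN, hkS⟩ ↦
      X2.mazurMainConjectureAt_of_algebraicLambdaGE hWu W p hp2 hmult hred hμ0 hlam halg hkN hkS,
    fun hMC ↦ exists_lambdaCount_of_mazurMainConjectureAt hpar hmult hμ0 hMC⟩

end Converse

end Summit.BirchSwinnertonDyer.BirchSwinnertonDyer.Theorems.EisensteinPrimesAnalyticLambdaCruxSized

end
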